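import Summits.QuantumFields.YangMills.Theorems.FluctuationComparisonRegPrIntLOrganTangentModeSectionOnSlice
import HarnessLib

/-!
# Crux `FluctuationComparisonRegPrIntL` (stmt-QuantumFields-20520, rung R3), PATH-B organ O1, LINE g26-1 «mode_section», repair R-UNIQ: THE STABILISER BRIDGE —
# from print's «unique critical ORBIT» (uniqueness modulo the FULL gauge group, V18-TYPING-SPEC §5 row) to the RESIDUAL edition consumed by
# ✓`…OrganTangentModeSectionOnSlice`, POINTWISE at data whose stabiliser lifts do not move the maximiser's residual orbit

Cell `ym3-torus` (YM ladder rung R3 = continuum `SU(2)` Yang–Mills on the three-torus — a RUNG: NOT d = 4, NOT infinite volume, NOT a mass gap, NOT Clay).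
Width seat `ym3-torus-px19` (gen 18); `--kind proof --supports stmt-QuantumFields-20520 --as helper`, count-neutral; DEFINITION-FREE (0 `def`, 0 `instance`,
0 `notation`, 0 `sorry`, default heartbeats).

WHY (LEAD w3 g24 WORD №5 (B)).  ✓`…OrganTangentModeSectionOnSlice.modeSection_of_uniqueFibreMax_modResidual` takes the one-well letter in its RESIDUAL edition
(«every maximiser over `V` is `u • Ustar` with `u (emb y) = 1`»); print's sentence ([Balaban1985Variational] Thm 1 p. 279) and the spec §5 row are the FULL-GROUP edition
(«… is `u • Ustar` for SOME fine `u`»).  The two differ exactly by the COARSE STABILISER of the datum: if `U = u • Ustar` and both lie over `V`, the coarse transformation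
`ū` induced by `u` fixes `V` (§1–§2: the one-step averaging `descend` is covariant for EVERY fine `u`, [Balaban1985Averaging] (11)), and `u` factors as
(residual) · (block-constant lift of `ū`).  Hence (§3) AT A DATUM `V`: full-orbit uniqueness + «every block-constant lift `z ↦ g (blockOf z)` that keeps `Ustar` in the
fibre moves `Ustar` inside its residual orbit» ⟹ residual uniqueness — the generic stratum (trivial∕central stabiliser, §3 `…_of_central`) and the flat datum with a
conjugation-fixed maximiser (LEAD №5: «at `V = 1` the flat maximiser is conjugation-fixed») included.  §4 lifts the pointwise bridge to the window hypothesis of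
✓`modeSection_of_uniqueFibreMax_modResidual` and re-runs it: MODE∘'s conclusion ⟸ {full-orbit one-well letter, the stabiliser-invariance clause, residual-invariant `r′`,
chart letters}.  The window-wide «central stabiliser» form is NOT typed: it is vacuous (`V = 1` lies in every window and every constant fixes it).

HONEST FRAMING: symmetry bookkeeping over hypothesis letters; nothing of Bałaban's analysis is asserted or proved; the one-well letter (either edition), the
stabiliser-invariance clause, MODE∘ (as a row), O1, the five registered ∘-stubs of `Lines/semiclassical_s2beta.lean` v11.4 (★★OWNER RULING №36, untouched), crux 20520
and `YM3TorusSU2` are NOT proved; rung R3 = SU(2) YM₃ on T³ at fixed lattice data — NOT d = 4, NOT infinite volume, NOT a mass gap, NOT Clay; the Yang–Mills mass gap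
is NOT proved by any of this.

References: T. Bałaban, CMP **102** (1985) 277–309 [Balaban1985Variational] ((4) p.278, Thm 1 p.279); CMP **98** (1985) 17–51 [Balaban1985Averaging] ((8), (11)–(13) p.19);
CMP **109** (1987) 249–301 [Balaban1987RG1] ((0.1) p.252, (0.4) p.253); CMP **102** (1985) 255–275 [Balaban1985UV3] ((42)–(44) p.266).
-/

set_option autoImplicit false

noncomputable section

namespace Summit.QuantumFields.YangMills.Theorems.OrganTangentResidualStabiliserBridge

open Filter Topology Set Function
open Literature.MathematicalPhysics.QuantumFieldTheory.Balaban1983to89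
open T3ContinuumYM3Torus T3NestedUnitLaws T3UnitLawDensityEML T3UnitScaleTilt T3LevelShift
open Literature.MathematicalPhysics.QuantumFieldTheory.Balaban1983to89.BlockAveragingHaarAC (centralBond)
open B10Eq27TorusAxialLog (axialT gaugeActT gaugeActT_eq_gaugeAct)
open B5Eq118OneStroke (iterBlockOf)
open B15DeterminingSets (embIter)
open Summit.QuantumFields.YangMills.Theorems.OrganTangentResidualAxialSection (gaugeActT_gaugeActT one_le_range)
open Summit.QuantumFields.YangMills.Theorems.OrganTangentModeSectionOnSlice (modeSection_of_uniqueFibreMax_modResidual)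

/-! ## §1 The one-step averaging is covariant for EVERY fine gauge transformation -/

section Covariance

variable (F : T3Family) {G : Type*} [GaugeGroup G] (ℰ : LoopAverage G)

/-- The standing range of the first averaging on the `(K+1)`-th torus. [cite: Balaban1987RG1, (0.1) p.252] -/
theorem zero_succ_le_range (K : ℕ) : 0 + 1 ≤ (F.P (K + 1)).m + (F.P (K + 1)).K := by
  change 0 + 1 ≤ F.m + (K + 1); omega

/-- ★ **`descend (u • U) = ū • descend U` FOR EVERY fine `u`**, with the induced coarse transformation `ū x = u (emb (siteShift _ x))` (the averaging axiom
`Averaging.covariant`, [Balaban1985Averaging] (11), read through the level identification `fieldShift` of the tree; the one-step twin of lit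
✓`T3PrintedRegularOrbits.descendTo_gaugeAct`; LEAD's ✓`descend_gaugeAct_of_residual` is the case `ū = 1`). [cite: Balaban1985Averaging, (11) p.19; Balaban1987RG1, (0.4) p.253] -/
theorem descend_gaugeAct (K : ℕ) (u : GaugeTransf (F.P (K + 1)) 0 G) (U : GaugeField (F.P (K + 1)) 0 G) :
    descend F ℰ K (GaugeField.gaugeAct u U) =
      GaugeField.gaugeAct (fun x => u (emb (siteShift (sitesPerDir_descend F K 0) x))) (descend F ℰ K U) := by
  unfold descend
  rw [(BlockAveraging.blockAvg (P := F.P (K + 1)) (j := 0) ℰ).covariant (zero_succ_le_range F K) u U]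
  -- `fieldShift` intertwines the gauge action (`u ↦ u ∘ siteShift`; the proof of lit ✓`T3LevelShift.fieldShift_gaugeAct`, re-run at these types)
  funext b
  show u (emb (bondShift (sitesPerDir_descend F K 0) b).src) *
      (BlockAveraging.blockAvg (P := F.P (K + 1)) (j := 0) ℰ).avg U (bondShift (sitesPerDir_descend F K 0) b) *
      (u (emb (bondShift (sitesPerDir_descend F K 0) b).tgt))⁻¹ = _
  rw [bondShift_tgt]
  rfl

/-- **Two fibre members related by a fine `u` force `ū` into the stabiliser of the datum.** [cite: Balaban1985Averaging, (11) p.19] -/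
theorem gaugeAct_coarse_eq_of_mem_fibre (K : ℕ) (u : GaugeTransf (F.P (K + 1)) 0 G) {U Ustar : GaugeField (F.P (K + 1)) 0 G}
    {V : GaugeField (F.P K) 0 G} (hUstar : descend F ℰ K Ustar = V) (hU : descend F ℰ K U = V) (hrel : U = GaugeField.gaugeAct u Ustar) :
    GaugeField.gaugeAct (fun x => u (emb (siteShift (sitesPerDir_descend F K 0) x))) V = V := by
  rw [← hUstar, ← descend_gaugeAct, ← hrel, hU, hUstar]

end Covariance

/-! ## §2 Factorisation of a fine transformation: (residual) · (block-constant lift of its coarse trace) -/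

section Factorisation

variable (F : T3Family) {G : Type*} [Group G]

omit [Group G] in
/-- The block-constant lift `z ↦ u (emb (blockOf z))` agrees with `u` at the centres. [cite: Balaban1987RG1, (0.1) p.252] -/
theorem lift_apply_emb (K : ℕ) (u : GaugeTransf (F.P (K + 1)) 0 G) (y : Site (F.P (K + 1)) 1) :
    u (emb (blockOf (emb y))) = u (emb y) := by
  rw [Site.blockOf_emb (zero_succ_le_range F K) y]

/-- ★ **`u = v · û`** with `v z := u z · (u (emb (blockOf z)))⁻¹` RESIDUAL (`v (emb y) = 1`) and `û z := u (emb (blockOf z))` block-constant.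
[cite: Balaban1985Variational, (4) p.278] -/
theorem residual_factor_emb (K : ℕ) (u : GaugeTransf (F.P (K + 1)) 0 G) (y : Site (F.P (K + 1)) 1) :
    u (emb y) * (u (emb (blockOf (emb y))))⁻¹ = 1 := by
  rw [lift_apply_emb F K u y, mul_inv_cancel]

/-- The factorisation at the level of actions: `u • W = v • (û • W)`. [cite: Balaban1985Averaging, (8) p.19] -/
theorem gaugeAct_eq_residual_gaugeAct_lift (K : ℕ) (u : GaugeTransf (F.P (K + 1)) 0 G) (W : GaugeField (F.P (K + 1)) 0 G) :
    gaugeActT u W = gaugeActT (fun z => u z * (u (emb (blockOf z)))⁻¹) (gaugeActT (fun z => u (emb (blockOf z))) W) := by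
  rw [gaugeActT_gaugeActT]
  congr 1
  funext z
  rw [inv_mul_cancel_right]

end Factorisation

/-! ## §3 The pointwise bridge: full-orbit uniqueness + stabiliser invariance of the residual orbit ⟹ residual uniqueness -/

section Bridge

variable (F : T3Family) {G : Type*} [GaugeGroup G] (ℰ : LoopAverage G)

/-- ★★ **THE STABILISER BRIDGE AT A DATUM.**  Suppose every BLOCK-CONSTANT fine transformation `z ↦ g (blockOf z)` (`g` a coarse-level
assignment) that keeps `Ustar` over `V` moves `Ustar` inside its RESIDUAL orbit.  Then every fibre member over `V` of the form `u • Ustar` (ANY fine `u`) is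
`w • Ustar` for a RESIDUAL `w` (`w (emb y) = 1`).  Proof: `u = v·û` (§2) with `v` residual and `û` the block-constant lift of `ū`; `û • Ustar` lies over `V`
because `u • Ustar` and `v` do not move data (§1 + ✓`descend_gaugeAct_of_residual`); so `û • Ustar = w₀ • Ustar` with `w₀` residual, and `w := v·w₀`.
[cite: Balaban1985Variational, (4) p.278 and Thm 1 p.279; Balaban1985Averaging, (11) p.19] -/
theorem exists_residual_of_gaugeAct_of_liftInvariant (K : ℕ) {V : GaugeField (F.P K) 0 G} {Ustar : GaugeField (F.P (K + 1)) 0 G}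
    (hinv : ∀ g : Site (F.P (K + 1)) 1 → G, descend F ℰ K (GaugeField.gaugeAct (fun z => g (blockOf z)) Ustar) = V →
      ∃ w : GaugeTransf (F.P (K + 1)) 0 G, (∀ y : Site (F.P (K + 1)) 1, w (emb y) = 1) ∧
        GaugeField.gaugeAct (fun z => g (blockOf z)) Ustar = GaugeField.gaugeAct w Ustar)
    {U : GaugeField (F.P (K + 1)) 0 G} (hU : descend F ℰ K U = V) (u : GaugeTransf (F.P (K + 1)) 0 G) (hrel : U = GaugeField.gaugeAct u Ustar) :
    ∃ w : GaugeTransf (F.P (K + 1)) 0 G, (∀ y : Site (F.P (K + 1)) 1, w (emb y) = 1) ∧ U = GaugeField.gaugeAct w Ustar := by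
  -- the factorisation `u • Ustar = v • (û • Ustar)`
  have hfac : GaugeField.gaugeAct u Ustar =
      GaugeField.gaugeAct (fun z => u z * (u (emb (blockOf z)))⁻¹) (GaugeField.gaugeAct (fun z => u (emb (blockOf z))) Ustar) := by
    rw [← gaugeActT_eq_gaugeAct, gaugeAct_eq_residual_gaugeAct_lift F K u Ustar]; rfl
  have hv : ∀ y : Site (F.P (K + 1)) 1, (fun z => u z * (u (emb (blockOf z)))⁻¹) (emb y) = 1 := fun y => residual_factor_emb F K u y
  -- `û • Ustar` lies over `V`: `descend (u • Ustar) = V` and `v` is residual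
  have hhat : descend F ℰ K (GaugeField.gaugeAct (fun z => (fun y : Site (F.P (K + 1)) 1 => u (emb y)) (blockOf z)) Ustar) = V := by
    have h1 : descend F ℰ K (GaugeField.gaugeAct u Ustar) = V := by rw [← hrel]; exact hU
    rw [hfac, OrganTangentUniqMaxResidualGauge.descend_gaugeAct_of_residual F ℰ K _ hv] at h1
    exact h1
  obtain ⟨w₀, hw₀, hw₀eq⟩ := hinv (fun y => u (emb y)) hhat
  refine ⟨fun z => u z * (u (emb (blockOf z)))⁻¹ * w₀ z, fun y => ?_, ?_⟩
  · show u (emb y) * (u (emb (blockOf (emb y))))⁻¹ * w₀ (emb y) = 1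
    rw [residual_factor_emb F K u y, one_mul, hw₀ y]
  · rw [hrel, hfac, hw₀eq]
    show gaugeActT (fun z => u z * (u (emb (blockOf z)))⁻¹) (gaugeActT w₀ Ustar) =
      gaugeActT (fun z => u z * (u (emb (blockOf z)))⁻¹ * w₀ z) Ustar
    rw [gaugeActT_gaugeActT]

/-- ★ **THE CENTRAL CASE** (generic stratum): if every coarse assignment `g` whose block-constant lift keeps `Ustar` over `V` is a CENTRAL CONSTANT, the
stabiliser-invariance clause holds with `w = 1` (central constants act trivially), so full-orbit uniqueness ⟹ residual uniqueness at `V`.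
[cite: Balaban1985Variational, (4) p.278; Balaban1985Averaging, (8) p.19] -/
theorem liftInvariant_of_central (K : ℕ) {V : GaugeField (F.P K) 0 G} {Ustar : GaugeField (F.P (K + 1)) 0 G}
    (hcen : ∀ g : Site (F.P (K + 1)) 1 → G, descend F ℰ K (GaugeField.gaugeAct (fun z => g (blockOf z)) Ustar) = V →
      ∃ c : G, (∀ y, g y = c) ∧ ∀ h : G, c * h = h * c) :
    ∀ g : Site (F.P (K + 1)) 1 → G, descend F ℰ K (GaugeField.gaugeAct (fun z => g (blockOf z)) Ustar) = V →
      ∃ w : GaugeTransf (F.P (K + 1)) 0 G, (∀ y : Site (F.P (K + 1)) 1, w (emb y) = 1) ∧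
        GaugeField.gaugeAct (fun z => g (blockOf z)) Ustar = GaugeField.gaugeAct w Ustar := by
  intro g hg
  obtain ⟨c, hc, hcomm⟩ := hcen g hg
  refine ⟨fun _ => 1, fun _ => rfl, ?_⟩
  funext b
  simp only [GaugeField.gaugeAct, hc, one_mul, inv_one, mul_one]
  -- `c * U b * c⁻¹ = U b` for central `c`
  rw [hcomm (Ustar b), mul_inv_cancel_right]

end Bridge

/-! ## §4 MODE∘'s conclusion from the FULL-ORBIT one-well letter + the stabiliser-invariance clause (re-run of ✓`…ModeSectionOnSlice`) -/

section Knit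

/-- ★★ **MODE∘ ⟸ {full-orbit one-well letter (spec §5 row shape: `… → ∃ u, U = u • Ustar`), stabiliser-invariance of the maximiser's residual orbit at every window
datum, residual-invariant `r′`, the per-bond chart letters}** — the hypothesis `hmax″` is print's «unique critical ORBIT» edition; `hstab` is the clause LEAD №5 (B) names
(«the full-group edition needs a stabiliser clause at symmetric data»); the conclusion is ✓`modeSection_of_uniqueFibreMax`'s VERBATIM.  Proof: §3 turns
(`hmax″`, `hstab`) into the residual edition `hmax′`, then ✓`…ModeSectionOnSlice.modeSection_of_uniqueFibreMax_modResidual`.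
[cite: Balaban1985Variational, Thm 1 p.279; Balaban1985UV3, (42)-(44) p.266; Balaban1987RG1, (0.4) p.253] -/
theorem modeSection_of_uniqueFibreOrbit_of_liftInvariant
    (F : T3Family) (γ b₀ p₀ : ℝ) (j : ℕ) (hθ : 0 < θBal F.L γ b₀ p₀ (j + 1))
    (r' : GaugeField (F.P (j + 1)) 0 ↥(Matrix.specialUnitaryGroup (Fin 2) ℂ) → ℝ)
    (hr' : ContinuousOn r' {U | PlaqSmall (θBal F.L γ b₀ p₀ (j + 1)) U})
    (hr'inv : ∀ u : GaugeTransf (F.P (j + 1)) 0 ↥(Matrix.specialUnitaryGroup (Fin 2) ℂ),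
      (∀ y : Site (F.P (j + 1)) 1, u (emb y) = 1) → ∀ U, r' (GaugeField.gaugeAct u U) = r' U)
    (hdc : ContinuousOn (descend F ℰp j : GaugeField (F.P (j + 1)) 0 ↥(Matrix.specialUnitaryGroup (Fin 2) ℂ) →
      GaugeField (F.P j) 0 ↥(Matrix.specialUnitaryGroup (Fin 2) ℂ)) {U | PlaqSmall (θBal F.L γ b₀ p₀ (j + 1)) U})
    (T : PBond (F.P j) 0 → GaugeField (F.P (j + 1)) 0 ↥(Matrix.specialUnitaryGroup (Fin 2) ℂ) → Set ↥(Matrix.specialUnitaryGroup (Fin 2) ℂ))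
    (θ : PBond (F.P j) 0 → GaugeField (F.P (j + 1)) 0 ↥(Matrix.specialUnitaryGroup (Fin 2) ℂ) →
      ↥(Matrix.specialUnitaryGroup (Fin 2) ℂ) → ↥(Matrix.specialUnitaryGroup (Fin 2) ℂ))
    (hTo : ∀ c U, IsOpen (T c U))
    (hθc : ∀ c U, ContinuousOn (θ c U) (T c U))
    (hright : ∀ c U, ∀ v ∈ T c U,
      descend F ℰp j (update U (centralBond (bondShift (sitesPerDir_descend F j 0) c)) (θ c U v)) c = v)
    (hsol : ∀ U : GaugeField (F.P (j + 1)) 0 ↥(Matrix.specialUnitaryGroup (Fin 2) ℂ), PlaqSmall (θBal F.L γ b₀ p₀ (j + 1)) U →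
      ∀ c, descend F ℰp j U c ∈ T c U ∧ θ c U (descend F ℰp j U c) = U (centralBond (bondShift (sitesPerDir_descend F j 0) c)))
    (hmax : ∀ V : GaugeField (F.P j) 0 ↥(Matrix.specialUnitaryGroup (Fin 2) ℂ), PlaqSmall (θBal F.L γ b₀ p₀ j) V →
      ∃ Ustar : GaugeField (F.P (j + 1)) 0 ↥(Matrix.specialUnitaryGroup (Fin 2) ℂ),
        descend F ℰp j Ustar = V ∧ PlaqSmall (θBal F.L γ b₀ p₀ (j + 1) / 2) Ustar ∧
        (∀ U, descend F ℰp j U = V → PlaqSmall (θBal F.L γ b₀ p₀ (j + 1)) U → r' U ≤ r' Ustar) ∧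
        (∀ U, descend F ℰp j U = V → PlaqSmall (θBal F.L γ b₀ p₀ (j + 1)) U → r' Ustar ≤ r' U →
          ∃ u : GaugeTransf (F.P (j + 1)) 0 ↥(Matrix.specialUnitaryGroup (Fin 2) ℂ), U = GaugeField.gaugeAct u Ustar) ∧
        (∀ g : Site (F.P (j + 1)) 1 → ↥(Matrix.specialUnitaryGroup (Fin 2) ℂ),
          descend F ℰp j (GaugeField.gaugeAct (fun z => g (blockOf z)) Ustar) = V →
          ∃ w : GaugeTransf (F.P (j + 1)) 0 ↥(Matrix.specialUnitaryGroup (Fin 2) ℂ), (∀ y : Site (F.P (j + 1)) 1, w (emb y) = 1) ∧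
            GaugeField.gaugeAct (fun z => g (blockOf z)) Ustar = GaugeField.gaugeAct w Ustar)) :
    ∃ Us : GaugeField (F.P j) 0 ↥(Matrix.specialUnitaryGroup (Fin 2) ℂ) → GaugeField (F.P (j + 1)) 0 ↥(Matrix.specialUnitaryGroup (Fin 2) ℂ),
      ContinuousOn Us {V | PlaqSmall (θBal F.L γ b₀ p₀ j) V} ∧
      (∀ V, PlaqSmall (θBal F.L γ b₀ p₀ j) V → descend F ℰp j (Us V) = V ∧ PlaqSmall (θBal F.L γ b₀ p₀ (j + 1) / 2) (Us V) ∧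
        ∀ U, descend F ℰp j U = V → PlaqSmall (θBal F.L γ b₀ p₀ (j + 1)) U → r' U ≤ r' (Us V)) := by
  refine modeSection_of_uniqueFibreMax_modResidual F γ b₀ p₀ j hθ r' hr' hr'inv hdc T θ hTo hθc hright hsol fun V hV => ?_
  obtain ⟨Ustar, hUd, hUh, hUmax, hUorb, hstab⟩ := hmax V hV
  refine ⟨Ustar, hUd, hUh, hUmax, fun U hU hUO hle => ?_⟩
  obtain ⟨u, hu⟩ := hUorb U hU hUO hle
  exact exists_residual_of_gaugeAct_of_liftInvariant F ℰp j hstab hU u hu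

end Knit

end Summit.QuantumFields.YangMills.Theorems.OrganTangentResidualStabiliserBridge

end
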